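import Summits.BirchSwinnertonDyer.BirchSwinnertonDyer.Theorems.UniversalToricDescentThinCombFrameInvolution
import Summits.BirchSwinnertonDyer.BirchSwinnertonDyer.Theorems.PrintCf2SplitBadTwoAvatarRigidity
import Literature.NumberTheory.GaloisRepresentations.AbsGaloisOuterConj
import Literature.NumberTheory.GaloisRepresentations.CMTypeHeckeCharacter
import Literature.NumberTheory.GaloisRepresentations.HeckeCharacterBaseChangeGaloisConjProofs
import Literature.NumberTheory.EllipticCurves.HeegnerPointsImaginaryQuadraticProofs
import Summits.BirchSwinnertonDyer.Rank1Residual.X11b.Three.LambdaSupplyTwistSupply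
import HarnessLib

/-!
# The REFLECTED AVATAR: the partner `ψ† = (ψ ∘ c̄)⁻¹` of a Hecke character under Büyükboduk–Lei's involution `τ : σ ↦ c σ⁻¹ c⁻¹`,
# its `p`-adic avatar `r†(g) = r(τ g)`, its infinity type and its passage through the pair
# (helper on the rational wall `RationalSplitIMCInclusionAtThree`, item stmt-BirchSwinnertonDyer-24207, line `ratwall_thin_comb` v8.2;
# cell `pub/bsd-wall`, LEAD `cruxlead-24207` g32; `--supports stmt-BirchSwinnertonDyer-24207`) — the dictionary «T-D» of LEAD-CENSUS-g32

WHY THIS FILE. The reflection transfer `…ThinComb.ReflectionTransfer.frameSubst_eq_self_of_toricUpTo₂_of_feRatio` (p766642) derives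
clause (ii) of `stub_toricExistsSymmUpTo2` (`φ_{A_τ} L₂ ∼ L₂`) from a supply of interpolation data `(ψ, a, b, r, L)` each equipped with a
PARTNER `(ψ′, b, a, r′, L′)` of the reflected type whose avatar sits at the reflected point, `r′(γ_j) = r(τ γ_j)`. This file constructs the
partner in the kernel, for `K` imaginary quadratic, `c ∈ Γ_ℚ`, `τ` a lift of `g ↦ c g⁻¹ c⁻¹` (`τ σ = θ_c(σ)⁻¹`, tree `…FrameInvolution.conjInv_eq`):

* §1 `isPAdicAvatarOf_galConj_outerConj` — **the conjugate representation `r^c = r ∘ θ_c` is the avatar of the conjugate character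
  `ψ ∘ c̄`** (`HeckeCharacter.galConj (absGaloisQuot ℚ K c) ψ`), for ANY Galois `K/ℚ`: Frobenius and inertia transport along `θ_c`
  (tree `FramedGaloisRep.hasFrobCharpolyAt_outerConj_iff`, `isUnramifiedAt_outerConj_iff`) and `(ψ∘c̄)(ϖ_v) = ψ(ϖ_{c̄ v})`
  (`HeckeCharacter.valueAtUniformizer_galConj_of_isUnramifiedAt`).
* §2 `isPAdicAvatarOf_inv_unitsChar` — **the inverse character `σ ↦ det r(σ)⁻¹` is the avatar of `ψ⁻¹`** (rank one; no hypothesis).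
* §3 THE REFLECTED AVATAR `r† := (det ∘ r ∘ θ_c)⁻¹` (as a framed rank-one representation): `avatarValueAt_reflected`
  (`r†(g) = r(θ_c g)⁻¹`), **`avatarValueAt_reflected_eq_conjInv`** (`r†(g) = r(τ g)` for a lift `τ` of `g ↦ c g⁻¹ c⁻¹`),
  **`isPAdicAvatarOf_reflected`** (`r†` is the avatar of `ψ† := (ψ ∘ c̄)⁻¹`), **`factorsThroughPair_reflected`** (`K` imaginary
  quadratic, any generator pair: `r†` factors through the pair when `r` does — `τ` preserves `Gal(K̄/K̃_∞)`,
  tree `…FrameInvolution.exists_linear_of_conjInv`).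
* §4 the character side for `K` imaginary quadratic and `c ∉ res(Γ_K)` (a complex conjugation): `absGaloisQuot_eq_complexConj`
  (`c̄` IS Mathlib's `IsCMField.complexConj K` read over `ℚ`), **`hasInfinityType_reflectedChar`** (`ψ` of tree type `(a, −b)` ⟹
  `ψ†` of tree type `(b, −a)` — the REFLECTED type, back in the cone `Σ⁺`), `isUnramifiedAt_reflectedChar` (everywhere unramified is
  preserved), and the assembled **`exists_reflected_partner`** in the binder shape of the transfer theorem.

What is NOT here (inputs of clause (ii) that stay): the complex functional equation relating the displays of `ψ` and `ψ†` (print; LEAD-CENSUS-g32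
§2: `κ^a V(ψ†) = κ^b V(ψ)`, `κ = N·D_K/4`), Jacquet's continuation at `ψ†`, and the fibred supply of `ψ`'s. Theorems only (no definition, no
instance, no notation, no `sorry`); nothing about elliptic curves is proved; BSD is not proved by any of this; 24207 stays OPEN.

References: Serre, *Abelian ℓ-adic representations* Ch. I §2.3, Ch. II §2.7 [cite: SerreAbelianLadic1968, Ch. I §2.3, Ch. II §2.7];
Castella–Hsieh 2018 §3.3 (avatars) [cite: CastellaHsieh2018, §3.3]; Büyükboduk–Lei Def. 3.8 (the involution `τ`)
[cite: BuyukbodukLei2017, Def. 3.8 (arXiv:1707.00557)]; Washington §13.1 [cite: Washington1997, §13.1]; Neukirch ANT Ch. I §9 (conjugate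
primes and Frobenii) [cite: NeukirchANT1999, Ch. I §9 (9.5)].
-/

set_option linter.dupNamespace false
set_option autoImplicit false

noncomputable section

open scoped MatrixGroups NumberField
open Field NumberField IsDedekindDomain
open Literature.NumberTheory.EllipticCurves Literature.NumberTheory.GaloisRepresentations
open Literature.NumberTheory.Automorphic

namespace Summit.BirchSwinnertonDyer.BirchSwinnertonDyer.Theorems.UniversalToricDescentThinComb.ReflectedAvatar

open Summit.BirchSwinnertonDyer.BirchSwinnertonDyer.Theorems.PrintCf2
open Summit.BirchSwinnertonDyer.Rank1Residual.X11b.Three.LambdaSupply (avatarValueAt_unitsChar)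

variable {p : ℕ} [Fact p.Prime] {K : Type} [Field K] [NumberField K]

/-! ## §0 Two bookkeeping lemmas -/

/-- A `ℚ`-automorphism fixes the natural numbers of `𝓞 K`, so `n ∈ 𝔭_{g • v} ↔ n ∈ 𝔭_v`. [folklore] -/
theorem natCast_mem_smul_asIdeal_iff (g : K ≃ₐ[ℚ] K) (v : HeightOneSpectrum (𝓞 K)) (n : ℕ) :
    ((n : 𝓞 K) ∈ (g • v).asIdeal ↔ (n : 𝓞 K) ∈ v.asIdeal) := by
  have h : g • (n : 𝓞 K) = n := by
    apply RingOfIntegers.ext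
    change g ((n : 𝓞 K) : K) = ((n : 𝓞 K) : K)
    simp
  rw [← HeightOneSpectrum.smul_mem_smul_asIdeal_iff g v (n : 𝓞 K), h]

omit [NumberField K] in
/-- `r(g⁻¹) = r(g)⁻¹` in `ℂ_p` for a rank-one framed representation. [folklore] -/
theorem avatarValueAt_inv (r : FramedGaloisRep K (PadicAlgCl p) 1) (g : absoluteGaloisGroup K) :
    avatarValueAt r g⁻¹ = (avatarValueAt r g)⁻¹ := by
  have h : avatarValueAt r g⁻¹ * avatarValueAt r g = 1 := by
    rw [← avatarValueAt_mul, inv_mul_cancel, avatarValueAt_one]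
  exact eq_inv_of_mul_eq_one_left h

/-! ## §1 The conjugate representation is the avatar of the conjugate character -/

/-- **`r ∘ θ_c` is the `p`-adic avatar of `ψ ∘ c̄`.** For `K/ℚ` Galois, `c ∈ Γ_ℚ` with image `c̄ = absGaloisQuot ℚ K c ∈ Gal(K/ℚ)`,
and `r` the avatar of the Hecke character `ψ`: the conjugate representation `r.outerConj c = r ∘ θ_c` is the avatar of the conjugate
character `HeckeCharacter.galConj c̄ ψ = ψ ∘ c̄`. Proof: `θ_c` carries the inertia groups and arithmetic Frobenii above `v` to those
above `c̄ • v` (tree), and `(ψ∘c̄)(ϖ_v) = ψ(ϖ_{c̄ • v})`. [cite: SerreAbelianLadic1968, Ch. I §2.3] [cite: NeukirchANT1999, Ch. I §9 (9.5)]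
[cite: CastellaHsieh2018, §3.3] -/
theorem isPAdicAvatarOf_galConj_outerConj [IsGalois ℚ K] (ι : PadicAlgCl p ≃+* ℂ) (c : absoluteGaloisGroup ℚ)
    {ψ : HeckeCharacter K} {r : FramedGaloisRep K (PadicAlgCl p) 1} (hr : IsPAdicAvatarOf ι ψ r) :
    IsPAdicAvatarOf ι (HeckeCharacter.galConj (absGaloisQuot ℚ K c) ψ) (r.outerConj c) := by
  intro v hv hunr
  set g := absGaloisQuot ℚ K c
  have hunr' : ψ.IsUnramifiedAt (g • v) := (HeckeCharacter.isUnramifiedAt_galConj_iff g ψ v).mp hunr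
  have hv' : ((p : ℕ) : 𝓞 K) ∉ (g • v).asIdeal := fun h ↦ hv ((natCast_mem_smul_asIdeal_iff g v p).mp h)
  obtain ⟨h1, h2⟩ := hr (g • v) hv' hunr'
  refine ⟨(FramedGaloisRep.isUnramifiedAt_outerConj_iff c r v).mpr h1, ?_⟩
  rw [HeckeCharacter.valueAtUniformizer_galConj_of_isUnramifiedAt g ψ v hunr']
  exact (FramedGaloisRep.hasFrobCharpolyAt_outerConj_iff c r v _).mpr h2

/-! ## §2 The inverse character is the avatar of the inverse Hecke character -/

omit [NumberField K] in
/-- The entry of the rank-one character `σ ↦ det r(σ)⁻¹` at `σ` is `(r(σ)₀₀)⁻¹`. [folklore] -/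
theorem entry_inv_unitsChar (r : FramedGaloisRep K (PadicAlgCl p) 1) (σ : absoluteGaloisGroup K) :
    ((((FramedRep.unitsContinuousMulEquivOfUnique (Fin 1) (PadicAlgCl p) :
        (PadicAlgCl p)ˣ →ₜ* GL (Fin 1) (PadicAlgCl p)).comp (detChar r)⁻¹ σ : GL (Fin 1) (PadicAlgCl p)) :
        Matrix (Fin 1) (Fin 1) (PadicAlgCl p)) 0 0) =
      ((((r σ : GL (Fin 1) (PadicAlgCl p)) : Matrix (Fin 1) (Fin 1) (PadicAlgCl p)) 0 0))⁻¹ := by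
  rw [ContinuousMonoidHom.comp_toFun, show (detChar r)⁻¹ σ = ((detChar r) σ)⁻¹ from rfl]
  change (((FramedRep.unitsContinuousMulEquivOfUnique (Fin 1) (PadicAlgCl p) ((detChar r) σ)⁻¹ :
      GL (Fin 1) (PadicAlgCl p)) : Matrix (Fin 1) (Fin 1) (PadicAlgCl p)) 0 0) = _
  rw [FramedRep.unitsContinuousMulEquivOfUnique_apply_coe, Units.val_inv_eq_inv_val, AvatarRigidity.coe_detChar_eq_entry]

omit [NumberField K] in
/-- The rank-one character `σ ↦ det r(σ)⁻¹` is trivial wherever `r` is. [folklore] -/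
theorem inv_unitsChar_apply_eq_one {r : FramedGaloisRep K (PadicAlgCl p) 1} {σ : absoluteGaloisGroup K} (h : r σ = 1) :
    (FramedRep.unitsContinuousMulEquivOfUnique (Fin 1) (PadicAlgCl p) :
        (PadicAlgCl p)ˣ →ₜ* GL (Fin 1) (PadicAlgCl p)).comp (detChar r)⁻¹ σ = 1 := by
  rw [ContinuousMonoidHom.comp_toFun, show (detChar r)⁻¹ σ = ((detChar r) σ)⁻¹ from rfl, detChar_apply, h, map_one, inv_one,
    map_one]

/-- **The inverse character `σ ↦ det r(σ)⁻¹` is the `p`-adic avatar of `ψ⁻¹`** whenever `r` is the avatar of `ψ` (rank one: inertia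
acts trivially on `r⁻¹` where it does on `r`, and the Frobenius entries invert, `ψ⁻¹(ϖ_v) = ψ(ϖ_v)⁻¹`).
[cite: SerreAbelianLadic1968, Ch. II §2.7] [cite: CastellaHsieh2018, §3.3] -/
theorem isPAdicAvatarOf_inv_unitsChar (ι : PadicAlgCl p ≃+* ℂ) {ψ : HeckeCharacter K}
    {r : FramedGaloisRep K (PadicAlgCl p) 1} (hr : IsPAdicAvatarOf ι ψ r) :
    IsPAdicAvatarOf ι ψ⁻¹ ((FramedRep.unitsContinuousMulEquivOfUnique (Fin 1) (PadicAlgCl p) :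
      (PadicAlgCl p)ˣ →ₜ* GL (Fin 1) (PadicAlgCl p)).comp (detChar r)⁻¹) := by
  intro v hv hunr
  have hunr' : ψ.IsUnramifiedAt v := by simpa using hunr.inv'
  obtain ⟨h1, h2⟩ := hr v hv hunr'
  refine ⟨fun 𝔓 h𝔓 σ hσ ↦ inv_unitsChar_apply_eq_one (h1 𝔓 h𝔓 σ hσ), ?_⟩
  rw [FramedGaloisRep.hasFrobCharpolyAt_iff_of_rank_one] at h2 ⊢
  intro 𝔓 h𝔓 Φ hΦ
  rw [entry_inv_unitsChar, h2 𝔓 h𝔓 Φ hΦ, HeckeCharacter.valueAtUniformizer_inv', map_inv₀]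

/-! ## §3 The reflected avatar `r† = (det ∘ r ∘ θ_c)⁻¹` -/

section Reflected

variable [IsGalois ℚ K]

/-- `r†(g) = r(θ_c g)⁻¹` in `ℂ_p`. [cite: CastellaHsieh2018, §3.3] -/
theorem avatarValueAt_reflected (c : absoluteGaloisGroup ℚ) (r : FramedGaloisRep K (PadicAlgCl p) 1)
    (g : absoluteGaloisGroup K) :
    avatarValueAt ((FramedRep.unitsContinuousMulEquivOfUnique (Fin 1) (PadicAlgCl p) :
      (PadicAlgCl p)ˣ →ₜ* GL (Fin 1) (PadicAlgCl p)).comp (detChar (r.outerConj c))⁻¹) g =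
      (avatarValueAt r (absGaloisOuterConj ℚ K c g))⁻¹ := by
  rw [avatarValueAt_unitsChar, show (detChar (r.outerConj c))⁻¹ g = ((detChar (r.outerConj c)) g)⁻¹ from rfl,
    Units.val_inv_eq_inv_val, avatarValueAt_eq_coe_detChar, detChar_apply, detChar_apply, FramedGaloisRep.outerConj_apply,
    PadicComplex.coe_eq, PadicComplex.coe_eq, map_inv₀]

/-- **`r†(g) = r(τ g)`** for ANY lift `τ : Γ_K → Γ_K` of `g ↦ c g⁻¹ c⁻¹` (`τ g = θ_c(g)⁻¹`, tree `…FrameInvolution.conjInv_eq`): the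
reflected avatar sits at the reflected point — the hypothesis `r′(γ_j) = r(σ γ_j)` of `…ReflectionTransfer.frameSubst_eq_self_of_toricUpTo₂_…`
for `σ = τ`. [cite: BuyukbodukLei2017, Def. 3.8 (arXiv:1707.00557)] [cite: Washington1997, §13.1] -/
theorem avatarValueAt_reflected_eq_conjInv {c : absoluteGaloisGroup ℚ} {τ : absoluteGaloisGroup K → absoluteGaloisGroup K}
    (hτ : ∀ σ, absGaloisRestrict ℚ K (τ σ) = c * (absGaloisRestrict ℚ K σ)⁻¹ * c⁻¹)
    (r : FramedGaloisRep K (PadicAlgCl p) 1) (g : absoluteGaloisGroup K) :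
    avatarValueAt ((FramedRep.unitsContinuousMulEquivOfUnique (Fin 1) (PadicAlgCl p) :
      (PadicAlgCl p)ˣ →ₜ* GL (Fin 1) (PadicAlgCl p)).comp (detChar (r.outerConj c))⁻¹) g =
      avatarValueAt r (τ g) := by
  rw [avatarValueAt_reflected, FrameInvolution.conjInv_eq hτ g, avatarValueAt_inv]

/-- **`r†` is the `p`-adic avatar of `ψ† := (ψ ∘ c̄)⁻¹`** (`c̄ = absGaloisQuot ℚ K c`): §1 then §2.
[cite: SerreAbelianLadic1968, Ch. I §2.3, Ch. II §2.7] [cite: CastellaHsieh2018, §3.3] -/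
theorem isPAdicAvatarOf_reflected (ι : PadicAlgCl p ≃+* ℂ) (c : absoluteGaloisGroup ℚ) {ψ : HeckeCharacter K}
    {r : FramedGaloisRep K (PadicAlgCl p) 1} (hr : IsPAdicAvatarOf ι ψ r) :
    IsPAdicAvatarOf ι (HeckeCharacter.galConj (absGaloisQuot ℚ K c) ψ)⁻¹
      ((FramedRep.unitsContinuousMulEquivOfUnique (Fin 1) (PadicAlgCl p) :
        (PadicAlgCl p)ˣ →ₜ* GL (Fin 1) (PadicAlgCl p)).comp (detChar (r.outerConj c))⁻¹) :=
  isPAdicAvatarOf_inv_unitsChar ι (isPAdicAvatarOf_galConj_outerConj ι c hr)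

/-- **`r†` factors through the pair when `r` does** (`K` imaginary quadratic, any generator pair `(κ₁, κ₂; γ₁, γ₂)`, `τ` a lift of
`g ↦ c g⁻¹ c⁻¹`): the characters `κ_i ∘ τ` are `ℤ_p`-combinations of `κ₁, κ₂` (tree `…FrameInvolution.exists_linear_of_conjInv`), so `τ`
— hence `θ_c` — preserves `Gal(K̄/K̃_∞) = ker κ₁ ∩ ker κ₂`. [cite: Washington1997, Thm. 13.4] [cite: deShalit1987, II.4.17 (54)] -/
theorem factorsThroughPair_reflected (hK : IsImaginaryQuadratic K) {κ₁ κ₂ : ZpExtension K p}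
    {γ₁ γ₂ : absoluteGaloisGroup K} (hpair : ZpExtension.IsTopGeneratorPair κ₁ κ₂ γ₁ γ₂)
    {c : absoluteGaloisGroup ℚ} {τ : absoluteGaloisGroup K → absoluteGaloisGroup K}
    (hτ : ∀ σ, absGaloisRestrict ℚ K (τ σ) = c * (absGaloisRestrict ℚ K σ)⁻¹ * c⁻¹)
    {r : FramedGaloisRep K (PadicAlgCl p) 1} (hr : FactorsThroughPair κ₁ κ₂ r) :
    FactorsThroughPair κ₁ κ₂ ((FramedRep.unitsContinuousMulEquivOfUnique (Fin 1) (PadicAlgCl p) :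
      (PadicAlgCl p)ˣ →ₜ* GL (Fin 1) (PadicAlgCl p)).comp (detChar (r.outerConj c))⁻¹) := by
  obtain ⟨M, hM⟩ := FrameInvolution.exists_linear_of_conjInv hK hpair hτ
  intro σ h₁ h₂
  -- `τ σ ∈ Gal(K̄/K̃_∞)`
  have hτ₁ : κ₁ (τ σ) = 1 := by
    have h := (hM σ).1
    rw [h₁, h₂] at h
    simpa using h
  have hτ₂ : κ₂ (τ σ) = 1 := by
    have h := (hM σ).2
    rw [h₁, h₂] at h
    simpa using h
  -- hence `θ_c σ = (τ σ)⁻¹ ∈ Gal(K̄/K̃_∞)` and `r (θ_c σ) = 1`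
  have hθ : absGaloisOuterConj ℚ K c σ = (τ σ)⁻¹ := by rw [FrameInvolution.conjInv_eq hτ σ, inv_inv]
  have hrθ : r (absGaloisOuterConj ℚ K c σ) = 1 := by
    rw [hθ, map_inv, hr (τ σ) hτ₁ hτ₂, inv_one]
  exact inv_unitsChar_apply_eq_one (by rwa [FramedGaloisRep.outerConj_apply])

end Reflected

/-! ## §4 The character side for `K` imaginary quadratic: `ψ† = (ψ ∘ c̄)⁻¹` has the reflected type -/

section Character

variable [IsGalois ℚ K]

/-- **For `K` imaginary quadratic and `c ∉ res(Γ_K)`, `c̄ = absGaloisQuot ℚ K c` is the complex conjugation of the CM field `K`**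
(Mathlib's `IsCMField.complexConj K`, read as a `ℚ`-automorphism): both are the non-trivial element of `Gal(K/ℚ)`, which has two
elements. [cite: Washington1997, §13.1] -/
theorem absGaloisQuot_eq_complexConj (hK : IsImaginaryQuadratic K) {c : absoluteGaloisGroup ℚ}
    (hc : c ∉ Set.range (absGaloisRestrict ℚ K)) :
    haveI := IsImaginaryQuadratic.isCMField hK
    absGaloisQuot ℚ K c = (IsCMField.complexConj K).restrictScalars ℚ := by
  haveI := IsImaginaryQuadratic.isCMField hK
  haveI : FiniteDimensional ℚ K := Module.finite_of_finrank_eq_succ hK.1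
  have hcbar : absGaloisQuot ℚ K c ≠ 1 := fun h ↦ hc ((absGaloisQuot_eq_one_iff ℚ K c).mp h)
  have hσ : (IsCMField.complexConj K).restrictScalars ℚ ≠ 1 := by
    intro h
    apply IsCMField.complexConj_ne_one K
    ext x
    have := AlgEquiv.congr_fun h x
    simpa using this
  have hcard : Fintype.card (K ≃ₐ[ℚ] K) ≤ 2 := hK.1 ▸ AlgEquiv.card_le
  by_contra hne
  have h3 : 2 < Fintype.card (K ≃ₐ[ℚ] K) := by
    rw [← Finset.card_univ]
    exact Finset.two_lt_card_iff.mpr ⟨1, absGaloisQuot ℚ K c, (IsCMField.complexConj K).restrictScalars ℚ,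
      Finset.mem_univ _, Finset.mem_univ _, Finset.mem_univ _, hcbar.symm, hσ.symm, hne⟩
  omega

/-- **`ψ ∘ c̄` is `ψ ∘ (complex conjugation)`** as Hecke characters, for `K` imaginary quadratic and `c ∉ res(Γ_K)`.
[cite: Washington1997, §13.1] -/
theorem galConj_absGaloisQuot_eq (hK : IsImaginaryQuadratic K) {c : absoluteGaloisGroup ℚ}
    (hc : c ∉ Set.range (absGaloisRestrict ℚ K)) (ψ : HeckeCharacter K) :
    haveI := IsImaginaryQuadratic.isCMField hK
    HeckeCharacter.galConj (absGaloisQuot ℚ K c) ψ = HeckeCharacter.galConj (IsCMField.complexConj K) ψ := by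
  haveI := IsImaginaryQuadratic.isCMField hK
  rw [absGaloisQuot_eq_complexConj hK hc, HeckeCharacter.galConj_restrictScalars]

/-- **THE REFLECTED TYPE.** For `K` imaginary quadratic, `c ∉ res(Γ_K)` and `ψ` of tree type `(a, −b)`
(`HasInfinityType (fun _ ↦ a) (fun _ ↦ −b)`; Castella–Wan `(−a, b) ∈ Σ⁺`), the partner `ψ† = (ψ ∘ c̄)⁻¹` has tree type `(b, −a)`
(Castella–Wan `(−b, a) ∈ Σ⁺`): conjugation swaps the two exponents (tree `HasInfinityType.galConj_complexConj`) and inversion negates them.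
[cite: CastellaHsieh2018, §3.3] [cite: CastellaWan2023, §2.1 (Σ⁺) (arXiv:1607.02019)] -/
theorem hasInfinityType_reflectedChar (hK : IsImaginaryQuadratic K) {c : absoluteGaloisGroup ℚ}
    (hc : c ∉ Set.range (absGaloisRestrict ℚ K)) {ψ : HeckeCharacter K} {a b : ℤ}
    (hinf : ψ.HasInfinityType (fun _ ↦ a) (fun _ ↦ -b)) :
    (HeckeCharacter.galConj (absGaloisQuot ℚ K c) ψ)⁻¹.HasInfinityType (fun _ ↦ b) (fun _ ↦ -a) := by
  haveI := IsImaginaryQuadratic.isCMField hK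
  rw [galConj_absGaloisQuot_eq hK hc]
  have h := (HeckeCharacter.HasInfinityType.galConj_complexConj hinf).inv
  convert h using 1 <;> funext _ <;> simp

omit [IsGalois ℚ K] in
/-- `ψ† = (ψ ∘ c̄)⁻¹` is unramified at `v` as soon as `ψ` is unramified at `c̄ • v`; in particular everywhere unramified is preserved.
[cite: TateThesis1967, Lemma 3.2.1] -/
theorem isUnramifiedAt_reflectedChar (g : K ≃ₐ[ℚ] K) {ψ : HeckeCharacter K}
    (hunr : ∀ w : HeightOneSpectrum (𝓞 K), ψ.IsUnramifiedAt w) (w : HeightOneSpectrum (𝓞 K)) :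
    (HeckeCharacter.galConj g ψ)⁻¹.IsUnramifiedAt w :=
  ((HeckeCharacter.isUnramifiedAt_galConj_iff g ψ w).mpr (hunr _)).inv'

/-- **THE REFLECTED PARTNER, assembled** in the binder shape of `…ReflectionTransfer.frameSubst_eq_self_of_toricUpTo₂_of_feRatio` with
`σ = τ`: for `K` imaginary quadratic, `c ∈ Γ_ℚ ∖ res(Γ_K)`, a lift `τ` of `g ↦ c g⁻¹ c⁻¹`, a generator pair, and an interpolation datum
`(ψ, a, b, r)` (type `(a, −b)`, everywhere unramified, avatar `r` through the pair), there is a partner `(ψ′, r′)` of type `(b, −a)`, everywhere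
unramified, `r′` the avatar of `ψ′` through the pair, with `r′(γ) = r(τ γ)` for EVERY `γ`; explicitly `ψ′ = (ψ ∘ c̄)⁻¹`. (The continuation
`L′` of `L(f/K, ψ′, s)` and the functional equation relating the displays are the remaining, printed, inputs.)
[cite: BuyukbodukLei2017, Def. 3.8 (arXiv:1707.00557)] [cite: CastellaHsieh2018, §3.3] [cite: SerreAbelianLadic1968, Ch. II §2.7] -/
theorem exists_reflected_partner (hK : IsImaginaryQuadratic K) (ι : PadicAlgCl p ≃+* ℂ) {κ₁ κ₂ : ZpExtension K p}
    {γ₁ γ₂ : absoluteGaloisGroup K} (hpair : ZpExtension.IsTopGeneratorPair κ₁ κ₂ γ₁ γ₂)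
    {c : absoluteGaloisGroup ℚ} (hc : c ∉ Set.range (absGaloisRestrict ℚ K))
    {τ : absoluteGaloisGroup K → absoluteGaloisGroup K}
    (hτ : ∀ σ, absGaloisRestrict ℚ K (τ σ) = c * (absGaloisRestrict ℚ K σ)⁻¹ * c⁻¹)
    {ψ : HeckeCharacter K} {a b : ℕ} (hinf : ψ.HasInfinityType (fun _ ↦ (a : ℤ)) (fun _ ↦ -(b : ℤ)))
    (hunr : ∀ w : HeightOneSpectrum (𝓞 K), ψ.IsUnramifiedAt w)
    {r : FramedGaloisRep K (PadicAlgCl p) 1} (hr : IsPAdicAvatarOf ι ψ r) (hrκ : FactorsThroughPair κ₁ κ₂ r) :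
    ∃ (ψ' : HeckeCharacter K) (r' : FramedGaloisRep K (PadicAlgCl p) 1),
      ψ' = (HeckeCharacter.galConj (absGaloisQuot ℚ K c) ψ)⁻¹ ∧
      ψ'.HasInfinityType (fun _ ↦ (b : ℤ)) (fun _ ↦ -(a : ℤ)) ∧
      (∀ w : HeightOneSpectrum (𝓞 K), ψ'.IsUnramifiedAt w) ∧
      IsPAdicAvatarOf ι ψ' r' ∧ FactorsThroughPair κ₁ κ₂ r' ∧
      ∀ g : absoluteGaloisGroup K, avatarValueAt r' g = avatarValueAt r (τ g) := by
  refine ⟨(HeckeCharacter.galConj (absGaloisQuot ℚ K c) ψ)⁻¹,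
    (FramedRep.unitsContinuousMulEquivOfUnique (Fin 1) (PadicAlgCl p) :
      (PadicAlgCl p)ˣ →ₜ* GL (Fin 1) (PadicAlgCl p)).comp (detChar (r.outerConj c))⁻¹, rfl,
    hasInfinityType_reflectedChar hK hc hinf, isUnramifiedAt_reflectedChar _ hunr, isPAdicAvatarOf_reflected ι c hr,
    factorsThroughPair_reflected hK hpair hτ hrκ, avatarValueAt_reflected_eq_conjInv hτ r⟩

end Character

end Summit.BirchSwinnertonDyer.BirchSwinnertonDyer.Theorems.UniversalToricDescentThinComb.ReflectedAvatar

end
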